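import Literature.AnabelianGeometry.EtaleTheta.SettingModelChiSemidirect
import Literature.AnabelianGeometry.EtaleTheta.SettingModelCuspAxis
import HarnessLib

/-!
# The χ-TWISTED model of the [EtTh] §1 root, part F4c: a CUSP DATUM — `curveχ′`, the variant of `curveχ`
# with ONE cusp whose inertia is the Tate-twisted `b`-axis (additive variant; R78 row R130 stage (S2))

Mochizuki, *The étale theta function …*, Publ. RIMS **45** (2009) [EtTh], §1, PRIMS PDF pp. 11–13
[cite: MochizukiEtTh2009, §1 p.13]: "any decomposition group of a cusp of `Y^log`"; Mochizuki, *Semi-graphs of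
anabelioids* [SemiAnbd], Publ. RIMS **42** (2006), §6 p. 71: "`D_x` always surjects onto an open subgroup of
`G_K`", "`I_x = D_x ∩ Δ^temp_X` is … isomorphic to `Ẑ(1)` if `x` is a cusp" [cite: MochizukiSemiAnbd2006, §6 p.71].

Cell abc-iut, layer L2, R78 cluster (abc-iut-L2-lead RULINGS #13 R100, row R130 «CUSP DATUM for curveχ», stage
(S2); integrator abc-iut-L6-d6 R78-MAP #3: "keep F4 (β) `Pt := PEmpty` as the default carrier and let (S2) be
an ADDITIVE variant `curveχ′`"; seat abc-iut-w5-d029).  Over abc-iut-w5-d249's F4 (`SettingModelChiSemidirect`: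
`PiTpχ p = Γ ⋊[actχ p] G_{ℚ_p}`, `curveχ p : TemperedCurve p` with no closed point) and this seat's (S1)
(`SettingModelCuspAxis`: the closed procyclic χ-stable axis `b^Ẑ ⊆ Γ`, `cuspDecomp`, `inertiaEquiv`):

* `cuspDecompχ p : Subgroup (PiTpχ p)` := `b^Ẑ ⋊ G_{ℚ_p}` (`= cuspDecomp (actχ p) _`; `actχ = twistGfp ∘ χ`
  stabilises the axis: `twistGfp_comp_stabilises`);
* its four `TemperedCurve` cusp clauses: `isClosed_cuspDecompχ`, `isOpen_augχ_image_cuspDecompχ` (the image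
  is ALL of `G_{ℚ_p}`), `nonempty_inertiaEquivχ : Nonempty (↥(D ⊓ Ker aug) ≃ₜ* Ẑ)`;
* **`curveχ′ p : TemperedCurve p`** — `curveχ p` with `Pt := Unit`, `IsCusp := ⊤`, `decomp _ := cuspDecompχ p`
  (same `K`, `Π^tp`, `aug`, `Π`, `toHat`, `augHat`; so every carrier-level theorem about `curveχ` transfers
  verbatim) — the FIRST model of `TemperedCurve p` in the tree with a closed point;
* bookkeeping for consumers: `curveχ′_PiTemp/aug/…` `rfl` lemmas, `decomp_curveχ′`, `isCusp_curveχ′`,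
  `inertia_curveχ′_eq` (`I_x = inl(b^Ẑ)`), `decomp_le_ker_gfpSnd` (clause (P3) of `OncePuncturedData` in the
  shape "`D_x ≤ Ker(Π^tp_X ↠ Z)`" for ANY degree map factoring through `gfpSnd ∘ left`, which F5's `toZχ` is),
  `map_aug_decomp_curveχ′ = ⊤ = G_K` (clause (P4)), `isCuspidalDecompositionGroup_cuspDecompχ`.

PRE-(S2) CONSUMER CHECK (L6-d6's ask, reported honestly): with this datum (i) every `TemperedCurve` cusp clause,
`OncePuncturedData` (P2)–(P4) and the SHAPE of `IsThm16Origin.exists_cuspidal_le_GtpY` become satisfiable at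
the χ-model; (ii) `Thm16Sub.GtpYNFromCusp` (R2: `Π^tp_{Y_N}` READ OFF a cusp section) is NOT satisfied for
`N ≥ 2` — `toEll(b^Ẑ) = (Δ^tp_Y)^ell` instead of `1` (the `b`-axis maps trivially to `Δ_Θ`, `ĥ_N(b^t) = (0,t,0)`,
and ONTO the ell-quotient) — it stays «genuine-models-only»; (iii) the `E`-indexed cusp records (`CuspidalPointDd`,
`DotCCusp`/`DotCCuspTorsor` over a `MuTwoSetting`) are downstream of F6/F7 and are not forced here.
HONEST LABEL (integrator's line): synthetic cusp datum — inertia := the Tate-twisted procyclic axis `b^Ẑ`; in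
print the cusp inertia is the boundary-commutator axis `⁅a,b⁆^Ẑ` (generating `Δ_Θ`), which is not twist-stable on
the nose in `F̂₂`, so the split decomposition group forces the `b`-axis.  Semi-synthetic model, consistency
evidence only — not the tempered `π₁` of a curve; [EtTh]/[SemiAnbd] refereed; typed ≠ proved; no side taken on
[IUTchIII] Cor. 3.12.  Post-freeze class (b) CONSTRUCTION; no instance, no Prop fact, F4's file untouched.
-/

noncomputable section

namespace Literature.AnabelianGeometry.EtaleTheta.SettingModel

open Literature.AnabelianGeometry.SemiGraphs _root_.Topology _root_.Function

variable (p : ℕ) [Fact p.Prime]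

/-! ### The cusp decomposition group `b^Ẑ ⋊ G_{ℚ_p} ≤ Π^tp_X` -/

/-- `actχ = twistGfp ∘ χ` stabilises the `b`-axis of `Γ`. [cite: MochizukiEtTh2009, §1 p.12] -/
theorem actχ_stabilises (σ : GQp p) {q : Gfp} (hq : q ∈ bAxisGfp) : actχ p σ q ∈ bAxisGfp :=
  twistGfp_comp_stabilises (chi p) σ hq

/-- **The decomposition group of the cusp**: `D := b^Ẑ ⋊ G_{ℚ_p} = {g | g.left ∈ b^Ẑ} ≤ Π^tp_X`.
[cite: MochizukiEtTh2009, §1 p.13] -/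
def cuspDecompχ : Subgroup (PiTpχ p) := cuspDecomp (actχ p) (actχ_stabilises p)

/-- [cite: MochizukiEtTh2009, §1 p.13] -/
theorem mem_cuspDecompχ_iff (g : PiTpχ p) : g ∈ cuspDecompχ p ↔ g.left ∈ bAxisGfp := Iff.rfl

/-- `D` is closed in `Π^tp_X`. [cite: MochizukiSemiAnbd2006, §6 p.71] -/
theorem isClosed_cuspDecompχ : IsClosed (cuspDecompχ p : Set (PiTpχ p)) :=
  isClosed_cuspDecomp (actχ p) (actχ_stabilises p) (Semidirect.continuous_left (isInducing_leftRightχ p))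

/-- `aug(D) = G_{ℚ_p}` (all of it). [cite: MochizukiSemiAnbd2006, §6 p.71] -/
theorem augχ_image_cuspDecompχ : (augχ p) '' (cuspDecompχ p : Set (PiTpχ p)) = Set.univ :=
  rightHom_image_cuspDecomp (actχ p) (actχ_stabilises p)

/-- Hence `aug(D)` is open. [cite: MochizukiSemiAnbd2006, §6 p.71] -/
theorem isOpen_augχ_image_cuspDecompχ : IsOpen ((augχ p) '' (cuspDecompχ p : Set (PiTpχ p))) := by
  rw [augχ_image_cuspDecompχ]
  exact isOpen_univ

/-- `map aug D = ⊤` (subgroup form; clause (P4) "`D_x ↠ G_K`", here `G_K = G_{ℚ_p}`). [cite: MochizukiEtTh2009, §1 p.13] -/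
theorem map_augχ_cuspDecompχ : (cuspDecompχ p).map (augχ p).toMonoidHom = ⊤ :=
  map_rightHom_cuspDecomp (actχ p) (actχ_stabilises p)

/-- **The inertia `I = D ∩ Ker(aug) = inl(b^Ẑ)`.** [cite: MochizukiSemiAnbd2006, §6 p.71] -/
theorem cuspDecompχ_inf_ker :
    cuspDecompχ p ⊓ (augχ p).toMonoidHom.ker = bAxisGfp.map (SemidirectProduct.inl : Gfp →* PiTpχ p) :=
  cuspDecomp_inf_ker_rightHom (actχ p) (actχ_stabilises p)

/-- **`I ≃ₜ* Ẑ`** (clause "`I_x ≅ Ẑ(1)`"). [cite: MochizukiSemiAnbd2006, §6 p.71] -/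
def inertiaEquivχ : ↥(cuspDecompχ p ⊓ (augχ p).toMonoidHom.ker) ≃ₜ* ZHat :=
  inertiaEquiv (actχ p) (actχ_stabilises p) (Semidirect.continuous_left (isInducing_leftRightχ p))
    (continuous_inlχ p)

/-- [cite: MochizukiSemiAnbd2006, §6 p.71] -/
theorem nonempty_inertiaEquivχ : Nonempty (↥(cuspDecompχ p ⊓ (augχ p).toMonoidHom.ker) ≃ₜ* ZHat) :=
  ⟨inertiaEquivχ p⟩

/-- **(P3)-shape**: the degree `Γ ↠ ℤ` vanishes on `D` — `D` lies in the `Π^tp_Y`-direction (for any `toZ` of the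
form `gfpSnd ∘ left`, as F5's). [cite: MochizukiEtTh2009, §1 p.13] -/
theorem gfpSnd_left_eq_one_of_mem_cuspDecompχ {g : PiTpχ p} (hg : g ∈ cuspDecompχ p) : gfpSnd g.left = 1 :=
  gfpSnd_left_eq_one_of_mem_cuspDecomp (actχ p) (actχ_stabilises p) hg

/-! ### `curveχ′`: the χ-model WITH a cusp -/

/-- **The tempered-curve layer of the χ-twisted model WITH ONE CUSP**: the data of `curveχ p` (`K := ℚ_p`,
`Π^tp := Γ ⋊_χ G_{ℚ_p}`, `Π := F̂₂ ⋊_χ G_{ℚ_p}`, …) with `Pt := Unit`, the point a cusp, `D_x := b^Ẑ ⋊ G_{ℚ_p}`.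
Additive variant (integrator's ruling); synthetic cusp (see the module docstring). [cite: MochizukiSemiAnbd2006, §6 p.71] -/
abbrev curveχ' : TemperedCurve p where
  K := (curveχ p).K
  finiteDimensional_K := (curveχ p).finiteDimensional_K
  PiTemp := PiTpχ p
  aug := augχ p
  range_aug := (curveχ p).range_aug
  PiHat := PiHtχ p
  toHat := toHatχ p
  isProfiniteCompletion_toHat := isProfiniteCompletion_toHatχ p
  toHat_injective := toHatχ_injective p
  augHat := augHatχ p
  augHat_comp := (curveχ p).augHat_comp
  Pt := Unit
  IsCusp _ := True
  decomp _ := cuspDecompχ p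
  isClosed_decomp _ := isClosed_cuspDecompχ p
  isOpen_aug_decomp _ := isOpen_augχ_image_cuspDecompχ p
  inertia_eq_bot _ h := (h trivial).elim
  inertia_equiv_zHat _ _ := nonempty_inertiaEquivχ p

/-- Same field, same group: `curveχ′` and `curveχ` share `Π^tp_X`. [cite: MochizukiEtTh2009, §1 p.12] -/
theorem curveχ'_PiTemp : (curveχ' p).PiTemp = (curveχ p).PiTemp := rfl

/-- … and the augmentation. [cite: MochizukiEtTh2009, §1 p.12] -/
theorem curveχ'_aug : (curveχ' p).aug = (curveχ p).aug := rfl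

/-- … and the completion. [cite: MochizukiEtTh2009, §1 p.12] -/
theorem curveχ'_toHat : (curveχ' p).toHat = (curveχ p).toHat := rfl

/-- … hence `Δ^tp`. [cite: MochizukiEtTh2009, §1 p.12] -/
theorem curveχ'_deltaTemp : (curveχ' p).DeltaTemp = (curveχ p).DeltaTemp := rfl

/-- … and `Δ_X`. [cite: MochizukiEtTh2009, §1 p.12] -/
theorem curveχ'_deltaHat : (curveχ' p).DeltaHat = (curveχ p).DeltaHat := rfl

/-- `curveχ′` HAS a cusp (its unique point). [cite: MochizukiEtTh2009, §1 p.12] -/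
theorem isCusp_curveχ' (x : (curveχ' p).Pt) : (curveχ' p).IsCusp x := trivial

/-- There is a cusp (the clause (P2) of `OncePuncturedData`). [cite: MochizukiEtTh2009, §1 p.12] -/
theorem exists_isCusp_curveχ' : ∃ x : (curveχ' p).Pt, (curveχ' p).IsCusp x := ⟨(), trivial⟩

/-- The decomposition group of the cusp is `b^Ẑ ⋊ G_{ℚ_p}`. [cite: MochizukiEtTh2009, §1 p.13] -/
theorem decomp_curveχ' (x : (curveχ' p).Pt) : (curveχ' p).decomp x = cuspDecompχ p := rfl

/-- Its inertia is `inl(b^Ẑ)`. [cite: MochizukiSemiAnbd2006, §6 p.71] -/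
theorem inertia_curveχ'_eq (x : (curveχ' p).Pt) :
    (curveχ' p).inertia x = bAxisGfp.map (SemidirectProduct.inl : Gfp →* PiTpχ p) :=
  cuspDecompχ_inf_ker p

/-- **(P4)**: the cusp is `K`-rational — `D_x` maps onto `G_K` (`= G_{ℚ_p}`, `K = ℚ_p`).
[cite: MochizukiEtTh2009, §1 p.13] -/
theorem map_aug_decomp_curveχ' (x : (curveχ' p).Pt) :
    ((curveχ' p).decomp x).map (curveχ' p).aug.toMonoidHom = (curveχ' p).GK := by
  change (cuspDecompχ p).map (augχ p).toMonoidHom = (⊥ : IntermediateField ℚ_[p] _).fixingSubgroup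
  rw [map_augχ_cuspDecompχ, IntermediateField.fixingSubgroup_bot]

/-- **(P3)-shape** at `curveχ′`: the degree `gfpSnd ∘ left` vanishes on every cuspidal decomposition group element.
[cite: MochizukiEtTh2009, §1 p.13] -/
theorem gfpSnd_left_eq_one_of_mem_decomp_curveχ' (x : (curveχ' p).Pt) {g : PiTpχ p}
    (hg : g ∈ (curveχ' p).decomp x) : gfpSnd g.left = 1 :=
  gfpSnd_left_eq_one_of_mem_cuspDecompχ p hg

/-- `b^Ẑ ⋊ G_{ℚ_p}` IS a cuspidal decomposition group of `curveχ′` (in L3's sense).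
[cite: MochizukiSemiAnbd2006, §6 p.71] -/
theorem isCuspidalDecompositionGroup_cuspDecompχ :
    (curveχ' p).IsCuspidalDecompositionGroup (cuspDecompχ p) :=
  ⟨(), trivial, 1, by rw [one_smul]⟩

/-- Non-vacuity bookkeeping: the first `TemperedCurve p` of the tree with a closed point.
[cite: MochizukiSemiAnbd2006, §6 p.71] -/
theorem nonempty_pt_curveχ' : Nonempty (curveχ' p).Pt := ⟨()⟩

end Literature.AnabelianGeometry.EtaleTheta.SettingModel

end
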